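import Summits.AtomisticToContinuum.HydrodynamicLimit.Theses.SpeedCapSurgery
import Summits.AtomisticToContinuum.HydrodynamicLimit.Theorems.SpeedCapSurgeryMaxSpeedBoundLogInitialSpeedTailLog
import Summits.AtomisticToContinuum.HydrodynamicLimit.Theorems.SpeedCapSurgeryMaxSpeedBoundLogEnergeticCollisionRecord
import Summits.AtomisticToContinuum.HydrodynamicLimit.Theorems.SpeedCapSurgeryMaxSpeedBoundLogNonStationaryFlux

/-!
# Birth skeleton — crux `MaxSpeedBoundLog` (stmt-AtomisticToContinuum-9629)

Route `route-AtomisticToContinuum-SpeedCapSurgery` (crux (MS), rank 2). The crux: for continuous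
positive local-Gibbs profiles there is `σ₀ > 0` such that for `0 < σ < σ₀`, every `t ≥ 0` and every
family of hard-sphere flows `Φ N` (`N + 1` spheres of diameter `σ(N+1)^{-1/3}` on `𝕋³`) there is
`C` with `localGibbsLaw {z | ∃ r ∈ [0,t], ∃ i, C √log(N+2) < ‖v_i(Φ_N(r) z)‖} → 0` — an `L∞`
speed cap at the extreme-value level of `N` Maxwellian speeds, along the DETERMINISTIC flow, for
all times (no Euler solution, no pre-shock restriction in the statement).

LINE (first moment over ENERGETIC COLLISIONS — the route header's own calibration, § Numbers /
`EquilibriumMaxSpeed`: "the event is contained in {max speed at time 0 > λ} ∪ {some collision in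
(0,t] has post-collisional pair energy > λ²}; … expected count ≲ t σ² (N+1)^{4/3} λ e^{-λ²/2θ}"):

* `stub_initialSpeedTailLog` (STATIC, size M): under the local Gibbs law, conditionally on the
  positions the velocities are independent Gaussians `N(u₀(q_i), θ₀(q_i)·1)` with
  `θ₀ ≤ θ_max`, `‖u₀‖ ≤ U` (continuous profiles on the compact torus), so for SOME `C₀`
  (any `C₀² > 2 θ_max`) `LG{∃ i, C₀ √log(N+2) < ‖v_i‖} ≤ (N+1)·(N+2)^{-C₀²/2θ_max + o(1)} → 0`
  (union bound over the `N + 1` marginals of `canonicalDensity`; the `𝒵 = 0` junk branch is the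
  zero measure). Every `σ > 0`, no dynamics.
* `stub_energeticCollisionRecord` (PATHWISE, deterministic, size M): on a good orbit, if every
  sphere has speed `≤ c` at time `0` and some sphere has speed `> c` at some `r ∈ [0,t]`, then at
  some collision time `r' ∈ (0,t]` the colliding pair `(i,j)` (`Φ_{r'} z ∈ contactSet i j`) has
  OUTGOING pair kinetic energy `‖v_i‖² + ‖v_j‖² > c²`. Proof sketch: collision times in `[0,r]`
  are finite (`IsHardSphereTrajectory.locFinite`); take the FIRST collision time `r'` at which
  some sphere is fast; on the preceding free-flight interval all velocities are `≤ c`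
  (`IsHardSphereTrajectory.free`, `freeFlight` keeps velocities; `flow_zero`), the left limit
  `z⁻` at `r'` has the same velocities, and `Φ_{r'} z = collidePair i j z⁻`
  (`IsHardSphereTrajectory.binary`) changes only `v_i, v_j` — so the fast sphere is `i` or `j`,
  and `c ≥ 0` gives pair energy `> c²` (pre- = post-collisional pair energy, so these are exactly
  the collisions with INCOMING pair energy above `c²`, the Stosszahlansatz-side quantity).
* `stub_energeticCollisionsRare` (DYNAMIC, the load-bearing a-priori estimate, open): in the
  crux's own frame (`∃ σ₀ ∀ σ < σ₀ ∀ t ≥ 0 ∀ Φ`) there are `C ≥ 0` and MEASURABLE majorants `g N`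
  of the number of collision times `r ∈ (0,t]` whose colliding pair has kinetic energy
  `> C² log(N+2)`, on good orbits, with `∫⁻ g N d(localGibbsLaw) → 0` (first-moment method: the
  expected count is the time integral of the one-collision intensity with pair energy above
  `λ² = C² log(N+2)`; at local equilibrium `≲ t σ² (N+1)^{4/3} λ e^{-λ²/(2θ_max)} =
  N^{4/3 - C²/(2θ_max) + o(1)} → 0` for `C² > 8θ_max/3`, § Numbers of the route). This is where a
  Povzner-type cascade bound / a ONE-rare-participant Stosszahlansatz ceiling along the
  non-equilibrium flow (the route's `ContactIntensityDominationOneRare`, stmt-16939, and glue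
  `TailsToMaxSpeedR`) bites; the measurable majorant absorbs the measurability of the collision
  count in the initial datum (not in the Literature: `HardSphereCollisionRecordMeasurable` §Design).

RESHAPE (cycle 2, lead c1, 2026-08-17): stub 3 is split at the skeleton level into
* `stub_energeticCollisionsRare_of_windowBound` (3a, PROVABLE NOW, landed by the lead in
  `Theorems/SpeedCapSurgeryMaxSpeedBoundLogNonStationaryFlux.lean`): the NON-STATIONARY
  Cercignani–Illner–Pulvirenti window reduction — for any law carried by the good set (here the
  local Gibbs law of ANY profiles) the mean of a functional dominated by a collision sum over
  `[0,t]` is at most `liminf_M Σ_{k=1}^{M}` of the means of the one-window functional under the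
  FIXED-TIME laws `LG_N ∘ Φ_{kt/M}⁻¹` (grid bound below the gap of the collision times, Fatou; the
  Literature lemma `lintegral_le_liminf_of_le_collisionSum` is its stationary special case), applied
  to `𝟙_good · eventSum` (measurable majorant of the energetic-collision count); and
* `stub_energeticWindowBound` (3b, OPEN, the load-bearing estimate in fixed-time form): `C ≥ 0`,
  tube families and `B N → 0` bounding those time-Riemann sums at level `C √log(N+2)`;
with `energeticCollisionsRare_of_window : 3a → 3b → EnergeticCollisionsRare` kernel-checked, so that
the composition is now `MaxSpeedBoundLog_of : stub₃_b → <crux BY NAME>` (3a, landed, is discharged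
inside like stubs 1–2). The open content of
the line is thereby a statement about ONE-TIME laws on TWO-BODY events of Liouville size
`≍ ε_N² (t/M) ‖vᵢ − vⱼ‖ 𝟙{energetic}` — no path-space / collision-count object remains in it.

ASSEMBLY (proved below, sorry-free; device of `Cruxes/MaxSpeedBoundPreShock/Lines/birth.lean`):
each stub statement is a `def X : Prop`, restated verbatim by its registered
`theorem stub_x : … := by sorry` (the only `sorry`s of the file) and aliased as
`__Registered.stub_x` (so the skeleton audit admits it as a hypothesis BY NAME);
`MaxSpeedBoundLog_of : __Registered.stub_energeticWindowBound → <crux by name>` (stubs 1, 2, 3a,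
landed, are discharged inside) is
the kernel-checked composition and the closing `example` applies it to the `stub_…` literally
(checking that defs, aliases and stubs agree). The argument (`speedEvent_measure_le`, per `N`, at level `c = C√log(N+2)` with
`C = max C₀ C₁`): `E_N ⊆ A_N ∪ goodᶜ ∪ {1 ≤ g_N}` (record lemma ⇒ the finite set of energetic
collision times in `(0,t]` — a subset of the locally finite collision times — is nonempty ⇒
`1 ≤ ncard ≤ g_N`, using monotonicity of the count in the level, `C₁ ≤ C`), `LG(goodᶜ) = 0`
(`localGibbsLaw = liouville.withDensity _ ≪ liouville`, `measure_compl_good`), Markov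
`LG{1 ≤ g_N} ≤ ∫⁻ g_N dLG`, `A_N(C) ⊆ A_N(C₀)` (`C₀ ≤ C`), subadditivity and a squeeze in `ℝ≥0∞`
with stubs 1 and 3.

Disproof used: none relevant — no `Cruxes/MaxSpeedBoundLog/Disproof.lean`, no `_false_without_`
theorem and no `Negative/` lemma exist for this crux at registration. Negatives honoured: the
refuted two-copies contact-intensity ceiling `ContactIntensityDomination` (stmt-9218, hot-spot
witness, both participants rare; `Theorems.not_SpeedCapSurgery_ContactIntensityDomination`) is NOT
assumed by any stub — stub 3 is an `N → ∞` statement about the true flow's own energetic-collision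
count, and any ceiling used to prove it must be the one-rare-participant form (16939-type: a pair
with energy `> λ²` has a participant with energy `> λ²/2`).
-/

namespace Summit.AtomisticToContinuum.HydrodynamicLimit.Cruxes.MaxSpeedBoundLog.Birth

open MeasureTheory Filter Set Topology
open scoped ENNReal

/-! ### The three statements of the line (precise `Prop`s) -/

/-- STATEMENT 1 (static extreme-value tail of the local Gibbs law at level `C₀ √log(N+2)` for
some `C₀`; see `stub_initialSpeedTailLog`). -/
def InitialSpeedTailLog : Prop :=
  ∀ (a₀ θ₀ : Literature.MathematicalPhysics.KineticTheory.T3 → ℝ)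
    (u₀ : Literature.MathematicalPhysics.KineticTheory.T3 → Literature.MathematicalPhysics.KineticTheory.V3),
    Continuous a₀ → Continuous θ₀ → Continuous u₀ → (∀ x, 0 < a₀ x) → (∀ x, 0 < θ₀ x) →
    ∀ σ : ℝ, 0 < σ →
    ∀ Φ : (N : ℕ) → Literature.Analysis.FluidPDE.HardSphereFlow
        (Literature.Analysis.FluidPDE.Torus.geometry (Fin 3))
        (Literature.MathematicalPhysics.KineticTheory.hsDiameter σ N) (N + 1),
    ∃ C₀ : ℝ, Filter.Tendsto (fun N : ℕ => Literature.MathematicalPhysics.KineticTheory.localGibbsLaw σ a₀ u₀ θ₀ N (Φ N)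
      {z | ∃ i, C₀ * Real.sqrt (Real.log ((N : ℝ) + 2)) < ‖(z i).2‖}) Filter.atTop (nhds 0)

/-- STATEMENT 2 (pathwise record lemma: a speed record above `c` absent at time `0` is set at a
collision whose colliding pair has (outgoing = incoming) kinetic energy above `c²`; see
`stub_energeticCollisionRecord`). -/
def EnergeticCollisionRecord : Prop :=
  ∀ (σ : ℝ) (N : ℕ)
    (Φ : Literature.Analysis.FluidPDE.HardSphereFlow
        (Literature.Analysis.FluidPDE.Torus.geometry (Fin 3))
        (Literature.MathematicalPhysics.KineticTheory.hsDiameter σ N) (N + 1))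
    (z : Literature.Analysis.FluidPDE.Config (N + 1) (Fin 3) Literature.MathematicalPhysics.KineticTheory.T3),
    z ∈ Φ.good → ∀ (c t : ℝ), (∀ i, ‖(z i).2‖ ≤ c) →
    (∃ r ∈ Set.Icc 0 t, ∃ i, c < ‖(Φ.flow r z i).2‖) →
    ∃ r ∈ Set.Ioc 0 t, ∃ i j : Fin (N + 1), i ≠ j ∧
      Φ.flow r z ∈ Literature.Analysis.FluidPDE.contactSet
          (Literature.Analysis.FluidPDE.Torus.geometry (Fin 3)) (N + 1)
          (Literature.MathematicalPhysics.KineticTheory.hsDiameter σ N) i j ∧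
      c ^ 2 < ‖(Φ.flow r z i).2‖ ^ 2 + ‖(Φ.flow r z j).2‖ ^ 2

/-- STATEMENT 3 (first-moment bound on energetic collisions along the flow, the load-bearing
a-priori estimate; see `stub_energeticCollisionsRare`). -/
def EnergeticCollisionsRare : Prop :=
  ∀ (a₀ θ₀ : Literature.MathematicalPhysics.KineticTheory.T3 → ℝ)
    (u₀ : Literature.MathematicalPhysics.KineticTheory.T3 → Literature.MathematicalPhysics.KineticTheory.V3),
    Continuous a₀ → Continuous θ₀ → Continuous u₀ → (∀ x, 0 < a₀ x) → (∀ x, 0 < θ₀ x) →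
    ∃ σ₀ : ℝ, 0 < σ₀ ∧ ∀ σ : ℝ, 0 < σ → σ < σ₀ → ∀ t : ℝ, 0 ≤ t →
    ∀ Φ : (N : ℕ) → Literature.Analysis.FluidPDE.HardSphereFlow
        (Literature.Analysis.FluidPDE.Torus.geometry (Fin 3))
        (Literature.MathematicalPhysics.KineticTheory.hsDiameter σ N) (N + 1),
    ∃ C : ℝ, 0 ≤ C ∧
    ∃ g : (N : ℕ) → Literature.Analysis.FluidPDE.Config (N + 1) (Fin 3) Literature.MathematicalPhysics.KineticTheory.T3 → ℝ≥0∞,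
      (∀ N, Measurable (g N)) ∧
      (∀ N, ∀ z ∈ (Φ N).good,
        ((Set.ncard {r ∈ Set.Ioc 0 t | ∃ i j : Fin (N + 1), i ≠ j ∧
            (Φ N).flow r z ∈ Literature.Analysis.FluidPDE.contactSet
                (Literature.Analysis.FluidPDE.Torus.geometry (Fin 3)) (N + 1)
                (Literature.MathematicalPhysics.KineticTheory.hsDiameter σ N) i j ∧
            (C * Real.sqrt (Real.log ((N : ℝ) + 2))) ^ 2 <
              ‖((Φ N).flow r z i).2‖ ^ 2 + ‖((Φ N).flow r z j).2‖ ^ 2} : ℕ) : ℝ≥0∞) ≤ g N z) ∧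
      Filter.Tendsto (fun N : ℕ => ∫⁻ z, g N z ∂(Literature.MathematicalPhysics.KineticTheory.localGibbsLaw σ a₀ u₀ θ₀ N (Φ N)))
        Filter.atTop (nhds 0)

/-- STATEMENT 3a (RESHAPE, cycle 2 — the provable half of STATEMENT 3: the NON-STATIONARY
Cercignani–Illner–Pulvirenti window reduction; see `stub_energeticCollisionsRare_of_windowBound`).
For `0 < σ < 1/2`, any profiles, `t > 0`, a flow family, `C ≥ 0`, tube families `S N M` with the
covering property at window length `t/M`, and `B N → 0` bounding the time-Riemann sums
`liminf_M Σ_{k=1}^{M} E_{LG_N}[Σ_{i≠j} 𝟙{lift of xᵢ−xⱼ ∈ S N M (vⱼ−vᵢ)} 𝟙{C² log(N+2) < ‖vᵢ‖²+‖vⱼ‖²} ∘ Φ_{kt/M}]`: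
the data demanded by STATEMENT 3 at `(σ, t, Φ)` (measurable majorants of the energetic-collision
count with vanishing mean). -/
def EnergeticCollisionsRareOfWindowBound : Prop :=
  ∀ (σ : ℝ), 0 < σ → σ < 1 / 2 →
    ∀ (a₀ θ₀ : Literature.MathematicalPhysics.KineticTheory.T3 → ℝ)
      (u₀ : Literature.MathematicalPhysics.KineticTheory.T3 → Literature.MathematicalPhysics.KineticTheory.V3)
      (t : ℝ), 0 < t →
    ∀ (Φ : (N : ℕ) → Literature.Analysis.FluidPDE.HardSphereFlow
        (Literature.Analysis.FluidPDE.Torus.geometry (Fin 3))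
        (Literature.MathematicalPhysics.KineticTheory.hsDiameter σ N) (N + 1)) (C : ℝ), 0 ≤ C →
    ∀ S : ℕ → ℕ → Literature.MathematicalPhysics.KineticTheory.V3 → Set Literature.MathematicalPhysics.KineticTheory.V3,
      (∀ N M, MeasurableSet {q : Literature.MathematicalPhysics.KineticTheory.V3 ×
        Literature.MathematicalPhysics.KineticTheory.V3 | q.1 ∈ S N M q.2}) →
      (∀ (N M : ℕ) (u r : Literature.MathematicalPhysics.KineticTheory.V3) (s : ℝ),
        Literature.MathematicalPhysics.KineticTheory.hsDiameter σ N ≤ ‖r‖ → s ∈ Set.Icc 0 (t / M) →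
        ‖r + s • u‖ = Literature.MathematicalPhysics.KineticTheory.hsDiameter σ N → r ∈ S N M u) →
    ∀ B : ℕ → ℝ≥0∞, Filter.Tendsto B Filter.atTop (nhds 0) →
      (∀ N : ℕ, Filter.liminf (fun M : ℕ => ∑ k ∈ Finset.Icc 1 M,
        ∫⁻ z, (∑ i : Fin (N + 1), ∑ j : Fin (N + 1), (if i ≠ j then
          {w : Literature.Analysis.FluidPDE.Config (N + 1) (Fin 3) Literature.MathematicalPhysics.KineticTheory.T3 |
              ∃ k : Fin 3 → ℤ, Literature.Analysis.FluidPDE.Torus.reprSym ((w i).1 - (w j).1) +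
                Literature.Analysis.FunctionSpaces.Torus.latticeVec k ∈ S N M ((w j).2 - (w i).2)}.indicator
            (fun w => Set.indicator {p : Literature.MathematicalPhysics.KineticTheory.V3 ×
                Literature.MathematicalPhysics.KineticTheory.V3 |
                (C * Real.sqrt (Real.log ((N : ℝ) + 2))) ^ 2 < ‖p.1‖ ^ 2 + ‖p.2‖ ^ 2}
              (fun _ => (1 : ℝ≥0∞)) ((w i).2, (w j).2))
            ((Φ N).flow ((k : ℝ) * (t / M)) z) else 0))
          ∂(Literature.MathematicalPhysics.KineticTheory.localGibbsLaw σ a₀ u₀ θ₀ N (Φ N))) Filter.atTop ≤ B N) →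
    ∃ C' : ℝ, 0 ≤ C' ∧
    ∃ g : (N : ℕ) → Literature.Analysis.FluidPDE.Config (N + 1) (Fin 3) Literature.MathematicalPhysics.KineticTheory.T3 → ℝ≥0∞,
      (∀ N, Measurable (g N)) ∧
      (∀ N, ∀ z ∈ (Φ N).good,
        ((Set.ncard {r ∈ Set.Ioc 0 t | ∃ i j : Fin (N + 1), i ≠ j ∧
            (Φ N).flow r z ∈ Literature.Analysis.FluidPDE.contactSet
                (Literature.Analysis.FluidPDE.Torus.geometry (Fin 3)) (N + 1)
                (Literature.MathematicalPhysics.KineticTheory.hsDiameter σ N) i j ∧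
            (C' * Real.sqrt (Real.log ((N : ℝ) + 2))) ^ 2 <
              ‖((Φ N).flow r z i).2‖ ^ 2 + ‖((Φ N).flow r z j).2‖ ^ 2} : ℕ) : ℝ≥0∞) ≤ g N z) ∧
      Filter.Tendsto (fun N : ℕ => ∫⁻ z, g N z ∂(Literature.MathematicalPhysics.KineticTheory.localGibbsLaw σ a₀ u₀ θ₀ N (Φ N)))
        Filter.atTop (nhds 0)

/-- STATEMENT 3b (RESHAPE, cycle 2 — the open half of STATEMENT 3, now a statement about the
FIXED-TIME laws `LG_N ∘ Φ_s⁻¹`, `s ≤ t`, on TWO-BODY events; see `stub_energeticWindowBound`). In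
the crux frame (profiles; `∃ σ₀`; `0 < σ < σ₀`; `t > 0`; any `Φ`) there are `C ≥ 0`, tube
families `S N M` with the covering property at window length `t/M` (the prover's choice, e.g. the
swept tubes of `exists_sweptTube`, of volume `≤ 4 ε_N² (t/M) ‖u‖`), and `B N → 0` such that for
every `N` the time-Riemann sums of the local-Gibbs means of the one-window energetic pair
functionals at level `C √log(N+2)` have `liminf_M ≤ B N`. -/
def EnergeticWindowBound : Prop :=
  ∀ (a₀ θ₀ : Literature.MathematicalPhysics.KineticTheory.T3 → ℝ)
    (u₀ : Literature.MathematicalPhysics.KineticTheory.T3 → Literature.MathematicalPhysics.KineticTheory.V3),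
    Continuous a₀ → Continuous θ₀ → Continuous u₀ → (∀ x, 0 < a₀ x) → (∀ x, 0 < θ₀ x) →
    ∃ σ₀ : ℝ, 0 < σ₀ ∧ ∀ σ : ℝ, 0 < σ → σ < σ₀ → ∀ t : ℝ, 0 < t →
    ∀ Φ : (N : ℕ) → Literature.Analysis.FluidPDE.HardSphereFlow
        (Literature.Analysis.FluidPDE.Torus.geometry (Fin 3))
        (Literature.MathematicalPhysics.KineticTheory.hsDiameter σ N) (N + 1),
    ∃ C : ℝ, 0 ≤ C ∧
    ∃ S : ℕ → ℕ → Literature.MathematicalPhysics.KineticTheory.V3 → Set Literature.MathematicalPhysics.KineticTheory.V3,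
      (∀ N M, MeasurableSet {q : Literature.MathematicalPhysics.KineticTheory.V3 ×
        Literature.MathematicalPhysics.KineticTheory.V3 | q.1 ∈ S N M q.2}) ∧
      (∀ (N M : ℕ) (u r : Literature.MathematicalPhysics.KineticTheory.V3) (s : ℝ),
        Literature.MathematicalPhysics.KineticTheory.hsDiameter σ N ≤ ‖r‖ → s ∈ Set.Icc 0 (t / M) →
        ‖r + s • u‖ = Literature.MathematicalPhysics.KineticTheory.hsDiameter σ N → r ∈ S N M u) ∧
    ∃ B : ℕ → ℝ≥0∞, Filter.Tendsto B Filter.atTop (nhds 0) ∧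
      ∀ N : ℕ, Filter.liminf (fun M : ℕ => ∑ k ∈ Finset.Icc 1 M,
        ∫⁻ z, (∑ i : Fin (N + 1), ∑ j : Fin (N + 1), (if i ≠ j then
          {w : Literature.Analysis.FluidPDE.Config (N + 1) (Fin 3) Literature.MathematicalPhysics.KineticTheory.T3 |
              ∃ k : Fin 3 → ℤ, Literature.Analysis.FluidPDE.Torus.reprSym ((w i).1 - (w j).1) +
                Literature.Analysis.FunctionSpaces.Torus.latticeVec k ∈ S N M ((w j).2 - (w i).2)}.indicator
            (fun w => Set.indicator {p : Literature.MathematicalPhysics.KineticTheory.V3 ×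
                Literature.MathematicalPhysics.KineticTheory.V3 |
                (C * Real.sqrt (Real.log ((N : ℝ) + 2))) ^ 2 < ‖p.1‖ ^ 2 + ‖p.2‖ ^ 2}
              (fun _ => (1 : ℝ≥0∞)) ((w i).2, (w j).2))
            ((Φ N).flow ((k : ℝ) * (t / M)) z) else 0))
          ∂(Literature.MathematicalPhysics.KineticTheory.localGibbsLaw σ a₀ u₀ θ₀ N (Φ N))) Filter.atTop ≤ B N

/-! ### The registered stubs `stub_…` (the only `sorry`s of the file; statements restated verbatim) -/

-- stub 1 `stub_initialSpeedTailLog`: LANDED (p148064) under this very name in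
-- `Theorems/SpeedCapSurgeryMaxSpeedBoundLogInitialSpeedTailLog.lean` (imported above); the composition
-- below refers to `stub_initialSpeedTailLog` = that theorem.

/-- stub 2 (PATHWISE record lemma, deterministic): on a good orbit of a hard-sphere flow, if every
sphere has speed `≤ c` at time `0` and some sphere has speed `> c` at some time `r ∈ [0, t]`,
then there is a collision time `r' ∈ (0, t]` whose colliding pair `(i, j)`
(`Φ_{r'} z ∈ contactSet i j`) has outgoing kinetic energy `‖v_i(r')‖² + ‖v_j(r')‖² > c²`.
Proof: `Φ.flow 0 z = z`; the collision times in `[0, r]` are finite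
(`IsHardSphereTrajectory.locFinite`) and, by free flight (`IsHardSphereTrajectory.free`,
`freeFlight` keeps velocities), nonempty with some sphere fast at the last one; at the FIRST
collision time `r'` carrying a fast sphere, the velocities on the preceding flight and of the left
limit `z⁻` are all `≤ c`, and `Φ_{r'} z = collidePair i j z⁻` (`IsHardSphereTrajectory.binary`)
moves only `v_i, v_j`; `c ≥ 0` since `‖(z 0).2‖ ≤ c`. [size M; provable now from
`HardSphereFlow.isTrajectory`; GST2013 §4.1 Def. 4.1.2, Alexander1975] -/
theorem stub_energeticCollisionRecord :
    ∀ (σ : ℝ) (N : ℕ)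
      (Φ : Literature.Analysis.FluidPDE.HardSphereFlow
          (Literature.Analysis.FluidPDE.Torus.geometry (Fin 3))
          (Literature.MathematicalPhysics.KineticTheory.hsDiameter σ N) (N + 1))
      (z : Literature.Analysis.FluidPDE.Config (N + 1) (Fin 3) Literature.MathematicalPhysics.KineticTheory.T3),
      z ∈ Φ.good → ∀ (c t : ℝ), (∀ i, ‖(z i).2‖ ≤ c) →
      (∃ r ∈ Set.Icc 0 t, ∃ i, c < ‖(Φ.flow r z i).2‖) →
      ∃ r ∈ Set.Ioc 0 t, ∃ i j : Fin (N + 1), i ≠ j ∧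
        Φ.flow r z ∈ Literature.Analysis.FluidPDE.contactSet
            (Literature.Analysis.FluidPDE.Torus.geometry (Fin 3)) (N + 1)
            (Literature.MathematicalPhysics.KineticTheory.hsDiameter σ N) i j ∧
        c ^ 2 < ‖(Φ.flow r z i).2‖ ^ 2 + ‖(Φ.flow r z j).2‖ ^ 2 :=
  -- LANDED (p147642): `Theorems/SpeedCapSurgeryMaxSpeedBoundLogEnergeticCollisionRecord.lean`
  Summit.AtomisticToContinuum.HydrodynamicLimit.Theorems.MaxSpeedBoundLogBirth.stub_energeticCollisionRecord

/-- stub 3a (RESHAPE, cycle 2; LANDED p155909 — the non-stationary CIP window reduction): the data of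
STATEMENT 3 at `(σ, t, Φ)` from vanishing time-Riemann sums of fixed-time one-window energetic pair
events. Proof (lead c1, `Theorems/SpeedCapSurgeryMaxSpeedBoundLogNonStationaryFlux.lean`):
`g N = 𝟙_good · eventSum Φ_N 0 t {C² log(N+2) < ‖v₁⁺‖²+‖v₂⁺‖²}` is measurable
(`censusLedger_eventMeasurable`), majorises the energetic-collision count
(`ncard_energetic_le_eventSum`), and is dominated on good orbits by the ordered-pair mark sum
(`eventSum_le_markSum`), whose local-Gibbs mean — for ANY profiles: only `localGibbsLaw ≪ liouville`
is used, no stationarity — is at most the `liminf` of the time-Riemann sums of the one-window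
functionals (pathwise grid bound `sum_collision_le_sum_window` below the gap of the collision times,
Fatou; Cercignani–Illner–Pulvirenti 1994 App. 4.A without the stationarity step). [size M] -/
theorem stub_energeticCollisionsRare_of_windowBound :
    ∀ (σ : ℝ), 0 < σ → σ < 1 / 2 →
      ∀ (a₀ θ₀ : Literature.MathematicalPhysics.KineticTheory.T3 → ℝ)
        (u₀ : Literature.MathematicalPhysics.KineticTheory.T3 → Literature.MathematicalPhysics.KineticTheory.V3)
        (t : ℝ), 0 < t →
      ∀ (Φ : (N : ℕ) → Literature.Analysis.FluidPDE.HardSphereFlow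
          (Literature.Analysis.FluidPDE.Torus.geometry (Fin 3))
          (Literature.MathematicalPhysics.KineticTheory.hsDiameter σ N) (N + 1)) (C : ℝ), 0 ≤ C →
      ∀ S : ℕ → ℕ → Literature.MathematicalPhysics.KineticTheory.V3 → Set Literature.MathematicalPhysics.KineticTheory.V3,
        (∀ N M, MeasurableSet {q : Literature.MathematicalPhysics.KineticTheory.V3 ×
          Literature.MathematicalPhysics.KineticTheory.V3 | q.1 ∈ S N M q.2}) →
        (∀ (N M : ℕ) (u r : Literature.MathematicalPhysics.KineticTheory.V3) (s : ℝ),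
          Literature.MathematicalPhysics.KineticTheory.hsDiameter σ N ≤ ‖r‖ → s ∈ Set.Icc 0 (t / M) →
          ‖r + s • u‖ = Literature.MathematicalPhysics.KineticTheory.hsDiameter σ N → r ∈ S N M u) →
      ∀ B : ℕ → ℝ≥0∞, Filter.Tendsto B Filter.atTop (nhds 0) →
        (∀ N : ℕ, Filter.liminf (fun M : ℕ => ∑ k ∈ Finset.Icc 1 M,
          ∫⁻ z, (∑ i : Fin (N + 1), ∑ j : Fin (N + 1), (if i ≠ j then
            {w : Literature.Analysis.FluidPDE.Config (N + 1) (Fin 3) Literature.MathematicalPhysics.KineticTheory.T3 |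
                ∃ k : Fin 3 → ℤ, Literature.Analysis.FluidPDE.Torus.reprSym ((w i).1 - (w j).1) +
                  Literature.Analysis.FunctionSpaces.Torus.latticeVec k ∈ S N M ((w j).2 - (w i).2)}.indicator
              (fun w => Set.indicator {p : Literature.MathematicalPhysics.KineticTheory.V3 ×
                  Literature.MathematicalPhysics.KineticTheory.V3 |
                  (C * Real.sqrt (Real.log ((N : ℝ) + 2))) ^ 2 < ‖p.1‖ ^ 2 + ‖p.2‖ ^ 2}
                (fun _ => (1 : ℝ≥0∞)) ((w i).2, (w j).2))
              ((Φ N).flow ((k : ℝ) * (t / M)) z) else 0))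
            ∂(Literature.MathematicalPhysics.KineticTheory.localGibbsLaw σ a₀ u₀ θ₀ N (Φ N))) Filter.atTop ≤ B N) →
      ∃ C' : ℝ, 0 ≤ C' ∧
      ∃ g : (N : ℕ) → Literature.Analysis.FluidPDE.Config (N + 1) (Fin 3) Literature.MathematicalPhysics.KineticTheory.T3 → ℝ≥0∞,
        (∀ N, Measurable (g N)) ∧
        (∀ N, ∀ z ∈ (Φ N).good,
          ((Set.ncard {r ∈ Set.Ioc 0 t | ∃ i j : Fin (N + 1), i ≠ j ∧
              (Φ N).flow r z ∈ Literature.Analysis.FluidPDE.contactSet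
                  (Literature.Analysis.FluidPDE.Torus.geometry (Fin 3)) (N + 1)
                  (Literature.MathematicalPhysics.KineticTheory.hsDiameter σ N) i j ∧
              (C' * Real.sqrt (Real.log ((N : ℝ) + 2))) ^ 2 <
                ‖((Φ N).flow r z i).2‖ ^ 2 + ‖((Φ N).flow r z j).2‖ ^ 2} : ℕ) : ℝ≥0∞) ≤ g N z) ∧
        Filter.Tendsto (fun N : ℕ => ∫⁻ z, g N z ∂(Literature.MathematicalPhysics.KineticTheory.localGibbsLaw σ a₀ u₀ θ₀ N (Φ N)))
          Filter.atTop (nhds 0) :=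
  -- LANDED (p155909): `Theorems/SpeedCapSurgeryMaxSpeedBoundLogNonStationaryFlux.lean`
  Summit.AtomisticToContinuum.HydrodynamicLimit.Theorems.MaxSpeedBoundLogLine.stub_energeticCollisionsRare_of_windowBound

/-- stub 3b (RESHAPE, cycle 2; the load-bearing a-priori estimate, OPEN — "the one-window
energetic pair events are rare under the fixed-time laws, summably over a time grid"): in the crux
frame (profiles; `∃ σ₀`; `0 < σ < σ₀`; `t > 0`; any `Φ`) there are `C ≥ 0`, tube families
`S N M` with the covering property (prover's choice; the swept tubes of `exists_sweptTube` have
volume `≤ 4 ε_N² (t/M) ‖vⱼ − vᵢ‖`) and `B N → 0` with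
`liminf_M Σ_{k=1}^{M} E_{LG_N}[Σ_{i≠j} 𝟙{lift of xᵢ−xⱼ ∈ S N M (vⱼ−vᵢ)} 𝟙{C² log(N+2) < ‖vᵢ‖²+‖vⱼ‖²} ∘ Φ_{kt/M}] ≤ B N`.
Why plausibly true (pre-shock): each summand is the probability-with-multiplicity, under the LAW AT
TIME `kt/M`, that an energetic ordered pair is within one window of contact; at local equilibrium
the pair law at contact is `≈ ρ² χ M_θ ⊗ M_θ`, so the summand is
`≲ (t/M) · 4(N+1)² ε_N² · ∫‖w−v‖ 𝟙{C² log(N+2) < ‖v‖²+‖w‖²} dM_θmax^{⊗2} = (t/M) N^{4/3 − C²/2θmax + o(1)}`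
and the sum is `→ 0` for `C² > 8 θmax/3` (§ Numbers of the route). CALIBRATION (lead c1, LANDED
p156882, `Theorems/SpeedCapSurgeryMaxSpeedBoundLogEquilibriumWindowBound.lean`,
`equilibrium_energeticWindowBound`): this stub, in its exact shape, is PROVED at constant profiles
`a₀ ≡ 1, u₀ ≡ 0, θ₀ ≡ θe` (invariant Gibbs law; explicit one-window event, static Gibbs bound
`C_p · 4ε²h · ∫‖w−v‖A`, `C_p = 5`, swept tubes, Gaussian flux tail; `B N = 5t(K+1)/(N+2)`). Why it
might fail: it is a bound on polynomially small (`N^{-K}`) two-body events under the non-equilibrium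
law at time `s`, invisible to the conserved `O(N)` relative entropy / `e^{O(N)}` density ratio
(HighMomentumCutoff barrier); and in the registered `∀ t` frame (here `∀ t > 0`, no Euler solution)
it inherits the post-shock focusing obstruction of the crux (Guderley; STRATEGY-CENSUS §Negation).
[size XL / open-problem; CIP1994 App. 4.A, GST2013 §4, Spohn1991, NachtergaeleYau2003 §2.3] -/
theorem stub_energeticWindowBound :
    ∀ (a₀ θ₀ : Literature.MathematicalPhysics.KineticTheory.T3 → ℝ)
      (u₀ : Literature.MathematicalPhysics.KineticTheory.T3 → Literature.MathematicalPhysics.KineticTheory.V3),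
      Continuous a₀ → Continuous θ₀ → Continuous u₀ → (∀ x, 0 < a₀ x) → (∀ x, 0 < θ₀ x) →
      ∃ σ₀ : ℝ, 0 < σ₀ ∧ ∀ σ : ℝ, 0 < σ → σ < σ₀ → ∀ t : ℝ, 0 < t →
      ∀ Φ : (N : ℕ) → Literature.Analysis.FluidPDE.HardSphereFlow
          (Literature.Analysis.FluidPDE.Torus.geometry (Fin 3))
          (Literature.MathematicalPhysics.KineticTheory.hsDiameter σ N) (N + 1),
      ∃ C : ℝ, 0 ≤ C ∧
      ∃ S : ℕ → ℕ → Literature.MathematicalPhysics.KineticTheory.V3 → Set Literature.MathematicalPhysics.KineticTheory.V3,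
        (∀ N M, MeasurableSet {q : Literature.MathematicalPhysics.KineticTheory.V3 ×
          Literature.MathematicalPhysics.KineticTheory.V3 | q.1 ∈ S N M q.2}) ∧
        (∀ (N M : ℕ) (u r : Literature.MathematicalPhysics.KineticTheory.V3) (s : ℝ),
          Literature.MathematicalPhysics.KineticTheory.hsDiameter σ N ≤ ‖r‖ → s ∈ Set.Icc 0 (t / M) →
          ‖r + s • u‖ = Literature.MathematicalPhysics.KineticTheory.hsDiameter σ N → r ∈ S N M u) ∧
      ∃ B : ℕ → ℝ≥0∞, Filter.Tendsto B Filter.atTop (nhds 0) ∧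
        ∀ N : ℕ, Filter.liminf (fun M : ℕ => ∑ k ∈ Finset.Icc 1 M,
          ∫⁻ z, (∑ i : Fin (N + 1), ∑ j : Fin (N + 1), (if i ≠ j then
            {w : Literature.Analysis.FluidPDE.Config (N + 1) (Fin 3) Literature.MathematicalPhysics.KineticTheory.T3 |
                ∃ k : Fin 3 → ℤ, Literature.Analysis.FluidPDE.Torus.reprSym ((w i).1 - (w j).1) +
                  Literature.Analysis.FunctionSpaces.Torus.latticeVec k ∈ S N M ((w j).2 - (w i).2)}.indicator
              (fun w => Set.indicator {p : Literature.MathematicalPhysics.KineticTheory.V3 ×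
                  Literature.MathematicalPhysics.KineticTheory.V3 |
                  (C * Real.sqrt (Real.log ((N : ℝ) + 2))) ^ 2 < ‖p.1‖ ^ 2 + ‖p.2‖ ^ 2}
                (fun _ => (1 : ℝ≥0∞)) ((w i).2, (w j).2))
              ((Φ N).flow ((k : ℝ) * (t / M)) z) else 0))
            ∂(Literature.MathematicalPhysics.KineticTheory.localGibbsLaw σ a₀ u₀ θ₀ N (Φ N))) Filter.atTop ≤ B N := by
  sorry

/-- STATEMENT 3 from the two halves of the reshape (kernel-checked): `σ₀ := min σ₀(3b) (1/2)`;
at `t = 0` the window `(0, 0]` is empty (`C = 0`, `g = 0`); at `t > 0` feed the data of 3b at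
`(σ, t, Φ)` to 3a. The cycle-1 results about STATEMENT 3 are untouched by the reshape: PROVED at
constant profiles (`equilibrium_energeticCollisionsRare`, p149299) and CONDITIONALLY on
`GaussianVelocityTails ∧ ContactIntensityDominationOneRare` (`energeticCollisionsRare_of`, p149442). -/
theorem energeticCollisionsRare_of_window (h3a : EnergeticCollisionsRareOfWindowBound)
    (h3b : EnergeticWindowBound) : EnergeticCollisionsRare := by
  intro a₀ θ₀ u₀ ha hθ hu hap hθp
  obtain ⟨σ₀, hσ₀, H⟩ := h3b a₀ θ₀ u₀ ha hθ hu hap hθp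
  refine ⟨min σ₀ (1 / 2), lt_min hσ₀ (by norm_num), fun σ hσ hσlt t ht Φ => ?_⟩
  have hσ₀' : σ < σ₀ := lt_of_lt_of_le hσlt (min_le_left _ _)
  have hσ2 : σ < 1 / 2 := lt_of_lt_of_le hσlt (min_le_right _ _)
  rcases ht.eq_or_lt with rfl | htpos
  · -- the window `(0, 0]` is empty: nothing to count
    refine ⟨0, le_rfl, fun _ _ => 0, fun _ => measurable_const, fun N z _ => ?_, ?_⟩
    swap
    · simpa only [MeasureTheory.lintegral_zero] using tendsto_const_nhds
    have hempty : {r ∈ Set.Ioc (0 : ℝ) 0 | ∃ i j : Fin (N + 1), i ≠ j ∧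
        (Φ N).flow r z ∈ Literature.Analysis.FluidPDE.contactSet
          (Literature.Analysis.FluidPDE.Torus.geometry (Fin 3)) (N + 1)
          (Literature.MathematicalPhysics.KineticTheory.hsDiameter σ N) i j ∧
        (0 * Real.sqrt (Real.log ((N : ℝ) + 2))) ^ 2 <
          ‖((Φ N).flow r z i).2‖ ^ 2 + ‖((Φ N).flow r z j).2‖ ^ 2} = ∅ := by
      ext r
      simp only [Set.Ioc_self, Set.mem_empty_iff_false, false_and, Set.mem_setOf_eq]
    rw [hempty, Set.ncard_empty]
    simp
  · obtain ⟨C, hC, S, hSm, hS, B, hB, hwin⟩ := H σ hσ hσ₀' t htpos Φ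
    exact h3a σ hσ hσ2 a₀ θ₀ u₀ t htpos Φ C hC S hSm hS B hB hwin

/-! ### Name-keyed aliases of the three statements (the hypotheses of the composition)

`__Registered.stub_x` is statement `X` under the registered stub's short name, so that the skeleton
audit (`#h21_check_skeleton`: hypotheses admissible iff registered obligations / declared stubs BY
NAME) accepts `MaxSpeedBoundLog_of : __Registered.stub_… → … → MaxSpeedBoundLog`; the namespace is an
implementation detail (the audit's stub report resolves each `stub_…` to the sorried theorem). -/
namespace __Registered

/-- Alias of `InitialSpeedTailLog` keyed by the registered stub name. -/
abbrev stub_initialSpeedTailLog : Prop := InitialSpeedTailLog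
/-- Alias of `EnergeticCollisionRecord` keyed by the registered stub name. -/
abbrev stub_energeticCollisionRecord : Prop := EnergeticCollisionRecord
/-- Alias of `EnergeticCollisionsRareOfWindowBound` keyed by the registered stub name. -/
abbrev stub_energeticCollisionsRare_of_windowBound : Prop := EnergeticCollisionsRareOfWindowBound
/-- Alias of `EnergeticWindowBound` keyed by the registered stub name. -/
abbrev stub_energeticWindowBound : Prop := EnergeticWindowBound

end __Registered

/-! ### The composition (kernel-checked, no `sorry`) -/

/-- PER-`N` UNION BOUND (the measure-theoretic core of the assembly): for a threshold `c`, a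
measurable majorant `g` of the number of collision times in `(0,t]` with colliding-pair energy
above `c²` on good orbits, and the record property at level `c`, the law of "some sphere faster
than `c` at some `r ∈ [0,t]`" is at most the law of "some sphere faster than `c` at time `0`"
plus `∫⁻ g`: `E ⊆ A ∪ goodᶜ ∪ {1 ≤ g}` (record lemma; the energetic collision times form a subset
of the locally finite collision times, so a nonempty one has `1 ≤ ncard ≤ g`), `LG(goodᶜ) = 0`
(`localGibbsLaw = liouville.withDensity _ ≪ liouville`, `measure_compl_good`), Markov
`LG{1 ≤ g} ≤ ∫⁻ g dLG`, subadditivity. -/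
theorem speedEvent_measure_le (σ : ℝ) (a₀ θ₀ : Literature.MathematicalPhysics.KineticTheory.T3 → ℝ)
    (u₀ : Literature.MathematicalPhysics.KineticTheory.T3 → Literature.MathematicalPhysics.KineticTheory.V3)
    (N : ℕ)
    (Φ : Literature.Analysis.FluidPDE.HardSphereFlow
        (Literature.Analysis.FluidPDE.Torus.geometry (Fin 3))
        (Literature.MathematicalPhysics.KineticTheory.hsDiameter σ N) (N + 1))
    (c t : ℝ)
    (g : Literature.Analysis.FluidPDE.Config (N + 1) (Fin 3) Literature.MathematicalPhysics.KineticTheory.T3 → ℝ≥0∞)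
    (hgm : Measurable g)
    (hgc : ∀ z ∈ Φ.good,
      ((Set.ncard {r ∈ Set.Ioc 0 t | ∃ i j : Fin (N + 1), i ≠ j ∧
          Φ.flow r z ∈ Literature.Analysis.FluidPDE.contactSet
              (Literature.Analysis.FluidPDE.Torus.geometry (Fin 3)) (N + 1)
              (Literature.MathematicalPhysics.KineticTheory.hsDiameter σ N) i j ∧
          c ^ 2 < ‖(Φ.flow r z i).2‖ ^ 2 + ‖(Φ.flow r z j).2‖ ^ 2} : ℕ) : ℝ≥0∞) ≤ g z)
    (hRecord : ∀ z ∈ Φ.good, (∀ i, ‖(z i).2‖ ≤ c) →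
      (∃ r ∈ Set.Icc 0 t, ∃ i, c < ‖(Φ.flow r z i).2‖) →
      ∃ r ∈ Set.Ioc 0 t, ∃ i j : Fin (N + 1), i ≠ j ∧
        Φ.flow r z ∈ Literature.Analysis.FluidPDE.contactSet
            (Literature.Analysis.FluidPDE.Torus.geometry (Fin 3)) (N + 1)
            (Literature.MathematicalPhysics.KineticTheory.hsDiameter σ N) i j ∧
        c ^ 2 < ‖(Φ.flow r z i).2‖ ^ 2 + ‖(Φ.flow r z j).2‖ ^ 2) :
    Literature.MathematicalPhysics.KineticTheory.localGibbsLaw σ a₀ u₀ θ₀ N Φ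
        {z | ∃ r ∈ Set.Icc 0 t, ∃ i, c < ‖(Φ.flow r z i).2‖}
      ≤ Literature.MathematicalPhysics.KineticTheory.localGibbsLaw σ a₀ u₀ θ₀ N Φ {z | ∃ i, c < ‖(z i).2‖}
        + ∫⁻ z, g z ∂(Literature.MathematicalPhysics.KineticTheory.localGibbsLaw σ a₀ u₀ θ₀ N Φ) := by
  set μ := Literature.MathematicalPhysics.KineticTheory.localGibbsLaw σ a₀ u₀ θ₀ N Φ with hμ
  -- step 1: the set inclusion `E ⊆ (A ∪ goodᶜ) ∪ {1 ≤ g}`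
  have hsub : {z | ∃ r ∈ Set.Icc 0 t, ∃ i, c < ‖(Φ.flow r z i).2‖}
      ⊆ ({z | ∃ i, c < ‖(z i).2‖} ∪ (Φ.good)ᶜ) ∪ {z | (1 : ℝ≥0∞) ≤ g z} := by
    intro z hz
    by_cases hA : z ∈ {z | ∃ i, c < ‖(z i).2‖}
    · exact Or.inl (Or.inl hA)
    by_cases hgood : z ∈ Φ.good
    · right
      have hA' : ∀ i, ‖(z i).2‖ ≤ c := fun i => not_lt.mp fun h => hA ⟨i, h⟩
      obtain ⟨r, hr, i, j, hij, hcontact, hE⟩ := hRecord z hgood hA' hz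
      -- the energetic collision times in `(0,t]` are among the (locally finite) collision times
      have hfin : {r ∈ Set.Ioc 0 t | ∃ i j : Fin (N + 1), i ≠ j ∧
          Φ.flow r z ∈ Literature.Analysis.FluidPDE.contactSet
              (Literature.Analysis.FluidPDE.Torus.geometry (Fin 3)) (N + 1)
              (Literature.MathematicalPhysics.KineticTheory.hsDiameter σ N) i j ∧
          c ^ 2 < ‖(Φ.flow r z i).2‖ ^ 2 + ‖(Φ.flow r z j).2‖ ^ 2}.Finite := by
        refine ((Φ.isTrajectory z hgood).locFinite 0 t).subset ?_
        intro r' hr'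
        obtain ⟨i', j', hij', hc', -⟩ := hr'.2
        exact ⟨⟨i', j', hij', hc'⟩, Set.Ioc_subset_Icc_self hr'.1⟩
      have hne : {r ∈ Set.Ioc 0 t | ∃ i j : Fin (N + 1), i ≠ j ∧
          Φ.flow r z ∈ Literature.Analysis.FluidPDE.contactSet
              (Literature.Analysis.FluidPDE.Torus.geometry (Fin 3)) (N + 1)
              (Literature.MathematicalPhysics.KineticTheory.hsDiameter σ N) i j ∧
          c ^ 2 < ‖(Φ.flow r z i).2‖ ^ 2 + ‖(Φ.flow r z j).2‖ ^ 2}.Nonempty :=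
        ⟨r, hr, i, j, hij, hcontact, hE⟩
      have hpos := (Set.ncard_pos hfin).mpr hne
      have h1 : (1 : ℝ≥0∞) ≤ ((Set.ncard {r ∈ Set.Ioc 0 t | ∃ i j : Fin (N + 1), i ≠ j ∧
          Φ.flow r z ∈ Literature.Analysis.FluidPDE.contactSet
              (Literature.Analysis.FluidPDE.Torus.geometry (Fin 3)) (N + 1)
              (Literature.MathematicalPhysics.KineticTheory.hsDiameter σ N) i j ∧
          c ^ 2 < ‖(Φ.flow r z i).2‖ ^ 2 + ‖(Φ.flow r z j).2‖ ^ 2} : ℕ) : ℝ≥0∞) := by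
        exact_mod_cast hpos
      exact le_trans h1 (hgc z hgood)
    · exact Or.inl (Or.inr hgood)
  -- step 2: bad initial data are Liouville-null, hence null for the local Gibbs law
  have hnull : μ (Φ.good)ᶜ = 0 := by
    rw [hμ]
    exact MeasureTheory.withDensity_absolutelyContinuous _ _ Φ.measure_compl_good
  -- step 3: Markov at level 1
  have hmarkov : μ {z | (1 : ℝ≥0∞) ≤ g z} ≤ ∫⁻ z, g z ∂μ := by
    have := MeasureTheory.mul_meas_ge_le_lintegral₀ hgm.aemeasurable (1 : ℝ≥0∞) (μ := μ)
    simpa using this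
  calc μ {z | ∃ r ∈ Set.Icc 0 t, ∃ i, c < ‖(Φ.flow r z i).2‖}
      ≤ μ (({z | ∃ i, c < ‖(z i).2‖} ∪ (Φ.good)ᶜ) ∪ {z | (1 : ℝ≥0∞) ≤ g z}) :=
        MeasureTheory.measure_mono hsub
    _ ≤ μ ({z | ∃ i, c < ‖(z i).2‖} ∪ (Φ.good)ᶜ) + μ {z | (1 : ℝ≥0∞) ≤ g z} :=
        MeasureTheory.measure_union_le _ _
    _ ≤ (μ {z | ∃ i, c < ‖(z i).2‖} + μ (Φ.good)ᶜ) + μ {z | (1 : ℝ≥0∞) ≤ g z} := by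
        gcongr
        exact MeasureTheory.measure_union_le _ _
    _ ≤ μ {z | ∃ i, c < ‖(z i).2‖} + ∫⁻ z, g z ∂μ := by
        rw [hnull, add_zero]
        gcongr

/-- **`MaxSpeedBoundLog` from the stubs** (BC3 form; after wave 1 and the cycle-2 reshape
`stub₃_b → <crux BY NAME>`, stubs 1, 2, 3a discharged inside by the landed theorems, STATEMENT 3
assembled from 3a + 3b by `energeticCollisionsRare_of_window`; sorry-free): take `σ₀` from STATEMENT 3; for admissible `σ, t, Φ` get `C₁ ≥ 0` and the measurable
majorants `g N` (STATEMENT 3) and `C₀` (STATEMENT 1); answer the crux with `C = max C₀ C₁`: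
`speedEvent_measure_le` at level `c = C √log(N+2)` — with `g N`, a majorant also at level `C`
because the energetic-collision count is antitone in the level (`C₁ ≤ C`, `0 ≤ C₁`), and
STATEMENT 2 — bounds the law of the crux event by `LG{fast at time 0 at level C} + ∫⁻ g N
≤ LG{fast at time 0 at level C₀} + ∫⁻ g N` (`C₀ ≤ C`), whose two terms tend to `0` by
STATEMENTS 1 and 3; squeeze in `ℝ≥0∞`. -/
theorem MaxSpeedBoundLog_of (hWindow : __Registered.stub_energeticWindowBound) :
    Summit.AtomisticToContinuum.HydrodynamicLimit.Theses.SpeedCapSurgery.MaxSpeedBoundLog := by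
  -- stubs 1, 2 and 3a are LANDED (p148064, p147642, p155909): discharged here by the imported theorems
  have hTail : __Registered.stub_initialSpeedTailLog := stub_initialSpeedTailLog
  have hRecord : __Registered.stub_energeticCollisionRecord := stub_energeticCollisionRecord
  have hWindowRed : __Registered.stub_energeticCollisionsRare_of_windowBound :=
    stub_energeticCollisionsRare_of_windowBound
  -- STATEMENT 3 from the reshape 3a + 3b
  have hRare : EnergeticCollisionsRare := energeticCollisionsRare_of_window hWindowRed hWindow
  intro a₀ θ₀ u₀ ha hθ hu hap hθp
  obtain ⟨σ₀, hσ₀, H⟩ := hRare a₀ θ₀ u₀ ha hθ hu hap hθp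
  refine ⟨σ₀, hσ₀, fun σ hσ hσlt t ht Φ => ?_⟩
  obtain ⟨C₁, hC₁, g, hgm, hgc, hgt⟩ := H σ hσ hσlt t ht Φ
  obtain ⟨C₀, hT⟩ := hTail a₀ θ₀ u₀ ha hθ hu hap hθp σ hσ Φ
  refine ⟨max C₀ C₁, ?_⟩
  have hC0 : C₀ ≤ max C₀ C₁ := le_max_left _ _
  have hC1 : C₁ ≤ max C₀ C₁ := le_max_right _ _
  -- monotonicity of the two levels in the constant
  have hlev : ∀ N : ℕ, C₀ * Real.sqrt (Real.log ((N : ℝ) + 2)) ≤ max C₀ C₁ * Real.sqrt (Real.log ((N : ℝ) + 2)) :=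
    fun N => mul_le_mul_of_nonneg_right hC0 (Real.sqrt_nonneg _)
  have hlev2 : ∀ N : ℕ, (C₁ * Real.sqrt (Real.log ((N : ℝ) + 2))) ^ 2
      ≤ (max C₀ C₁ * Real.sqrt (Real.log ((N : ℝ) + 2))) ^ 2 := by
    intro N
    have hs : 0 ≤ Real.sqrt (Real.log ((N : ℝ) + 2)) := Real.sqrt_nonneg _
    rw [sq, sq]
    exact mul_self_le_mul_self (mul_nonneg hC₁ hs) (mul_le_mul_of_nonneg_right hC1 hs)
  -- the per-`N` bound
  have hbound : ∀ N : ℕ,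
      Literature.MathematicalPhysics.KineticTheory.localGibbsLaw σ a₀ u₀ θ₀ N (Φ N)
          {z | ∃ r ∈ Set.Icc 0 t, ∃ i, max C₀ C₁ * Real.sqrt (Real.log ((N : ℝ) + 2)) < ‖((Φ N).flow r z i).2‖}
        ≤ Literature.MathematicalPhysics.KineticTheory.localGibbsLaw σ a₀ u₀ θ₀ N (Φ N)
            {z | ∃ i, C₀ * Real.sqrt (Real.log ((N : ℝ) + 2)) < ‖(z i).2‖}
          + ∫⁻ z, g N z ∂(Literature.MathematicalPhysics.KineticTheory.localGibbsLaw σ a₀ u₀ θ₀ N (Φ N)) := by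
    intro N
    refine le_trans (speedEvent_measure_le σ a₀ θ₀ u₀ N (Φ N)
      (max C₀ C₁ * Real.sqrt (Real.log ((N : ℝ) + 2))) t (g N) (hgm N) ?_
      (fun z hz => hRecord σ N (Φ N) z hz (max C₀ C₁ * Real.sqrt (Real.log ((N : ℝ) + 2))) t)) ?_
    · -- `g N` majorises the level-`C` count because it majorises the (larger) level-`C₁` count
      intro z hz
      refine le_trans ?_ (hgc N z hz)
      have hfin : {r ∈ Set.Ioc 0 t | ∃ i j : Fin (N + 1), i ≠ j ∧
          (Φ N).flow r z ∈ Literature.Analysis.FluidPDE.contactSet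
              (Literature.Analysis.FluidPDE.Torus.geometry (Fin 3)) (N + 1)
              (Literature.MathematicalPhysics.KineticTheory.hsDiameter σ N) i j ∧
          (C₁ * Real.sqrt (Real.log ((N : ℝ) + 2))) ^ 2 <
            ‖((Φ N).flow r z i).2‖ ^ 2 + ‖((Φ N).flow r z j).2‖ ^ 2}.Finite := by
        refine (((Φ N).isTrajectory z hz).locFinite 0 t).subset ?_
        intro r' hr'
        obtain ⟨i', j', hij', hc', -⟩ := hr'.2
        exact ⟨⟨i', j', hij', hc'⟩, Set.Ioc_subset_Icc_self hr'.1⟩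
      have hsubset : {r ∈ Set.Ioc 0 t | ∃ i j : Fin (N + 1), i ≠ j ∧
          (Φ N).flow r z ∈ Literature.Analysis.FluidPDE.contactSet
              (Literature.Analysis.FluidPDE.Torus.geometry (Fin 3)) (N + 1)
              (Literature.MathematicalPhysics.KineticTheory.hsDiameter σ N) i j ∧
          (max C₀ C₁ * Real.sqrt (Real.log ((N : ℝ) + 2))) ^ 2 <
            ‖((Φ N).flow r z i).2‖ ^ 2 + ‖((Φ N).flow r z j).2‖ ^ 2}
        ⊆ {r ∈ Set.Ioc 0 t | ∃ i j : Fin (N + 1), i ≠ j ∧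
          (Φ N).flow r z ∈ Literature.Analysis.FluidPDE.contactSet
              (Literature.Analysis.FluidPDE.Torus.geometry (Fin 3)) (N + 1)
              (Literature.MathematicalPhysics.KineticTheory.hsDiameter σ N) i j ∧
          (C₁ * Real.sqrt (Real.log ((N : ℝ) + 2))) ^ 2 <
            ‖((Φ N).flow r z i).2‖ ^ 2 + ‖((Φ N).flow r z j).2‖ ^ 2} := by
        intro r' hr'
        obtain ⟨i', j', hij', hc', hE'⟩ := hr'.2
        exact ⟨hr'.1, i', j', hij', hc', lt_of_le_of_lt (hlev2 N) hE'⟩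
      exact_mod_cast Set.ncard_le_ncard hsubset hfin
    · -- the time-`0` event shrinks as the constant grows: level `C` versus level `C₀`
      refine add_le_add ?_ le_rfl
      refine MeasureTheory.measure_mono fun z hz => ?_
      obtain ⟨i, hi⟩ := hz
      exact ⟨i, lt_of_le_of_lt (hlev N) hi⟩
  have hsum : Filter.Tendsto (fun N : ℕ =>
      Literature.MathematicalPhysics.KineticTheory.localGibbsLaw σ a₀ u₀ θ₀ N (Φ N)
          {z | ∃ i, C₀ * Real.sqrt (Real.log ((N : ℝ) + 2)) < ‖(z i).2‖}
        + ∫⁻ z, g N z ∂(Literature.MathematicalPhysics.KineticTheory.localGibbsLaw σ a₀ u₀ θ₀ N (Φ N)))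
      Filter.atTop (nhds 0) := by
    simpa using hT.add hgt
  exact tendsto_of_tendsto_of_tendsto_of_le_of_le tendsto_const_nhds hsum (fun N => zero_le) hbound

/-- REGISTERED SKELETON, CLOSED FORM: the crux BY NAME from the three `stub_…` literally (an
`example`, so that the skeleton audit's candidate theorem is `MaxSpeedBoundLog_of` alone; it
type-checks only because defs, aliases and stub statements agree, and it is a closed proof of the
crux exactly when the three stubs are proved). -/
example : Summit.AtomisticToContinuum.HydrodynamicLimit.Theses.SpeedCapSurgery.MaxSpeedBoundLog :=
  MaxSpeedBoundLog_of stub_energeticWindowBound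

end Summit.AtomisticToContinuum.HydrodynamicLimit.Cruxes.MaxSpeedBoundLog.Birth
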